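import Mathlib
import Literature.Analysis.FluidPDE.DivCurlAnnihilator
import Literature.Analysis.FluidPDE.SuitableWeakCongr
import Summits.NavierStokesRegularity.NavierStokesRegularity.Theorems.EulerZoomLiouvillePowerGaugeEulerLiouvilleSeparableEulerBrackets
import Summits.NavierStokesRegularity.NavierStokesRegularity.Theorems.EulerZoomLiouvillePowerGaugeEulerLiouvilleAffineTimePast
import Summits.NavierStokesRegularity.NavierStokesRegularity.Theorems.EulerZoomLiouvillePowerGaugeEulerLiouvilleIrrotationalTools
import HarnessLib

/-!
# Crux `EulerZoomLiouville.PowerGaugeEulerLiouville` (stmt-NavierStokesRegularity-19832), stub `stub_nonSelfSimilarRest`: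
# SEPARABLE PASTS ARE TRIVIAL UNLESS THE MODULATION SOLVES THE COLLAPSE ODE `θ' = λ θ²`

Helper file (theorems only; `--supports stmt-NavierStokesRegularity-19832`; def-free).  Hand leafhand-ns-eulerzoomliouville-11 g0;
closes the separable lane opened by `…SeparablePast` (non-evanescent modulation, gauges only) using the Euler identity itself
(`…SeparableEulerBrackets`).

THE STRATUM.  A member `(u, p, H, c)` (`ρ > 0`) with `u(τ, x) = θ(τ) U(x)` for a.e. `(τ, x) ∈ (−∞, T₁) × ℝ³` (`T₁ ≤ 0`, `U : ℝ³ → ℝ³`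
ARBITRARY, `θ ∈ C¹(ℝ)`) such that `θ` does NOT satisfy `θ' = λθ²` on `(−∞, T₁)` for any constant `λ` vanishes a.e. on the slab
(`SeparableEuler.ae_eq_zero_of_gauge_of_aeSeparableEuler`, binder `Birth.nonSelfSimilar_of_aeSeparableEuler`).  The excluded
modulations are exactly `θ ≡ 0` (trivial), `θ ≡ const` (the steady past, tree `PastSteady`/`AePastSteady`) and `θ(τ) = 1/(λ(T − τ))`
— the `γ = 0` self-similar collapse `u = V(x)/(T − τ)`, which is therefore the ONLY separable time structure left in `stub_nonSelfSimilarRest`.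

PROOF.  A good slice `τ₀` with `θ(τ₀) ≠ 0` gives `U ∈ L¹_loc`, `|U|² ∈ L¹_loc` and the growth `∫_{B_r}|U|² ≤ (c/θ(τ₀)²) r^{1−2ρ}`
(`A`-gauge).  The a.e.-modified field `v = θ(τ)U` (`τ < T₁`), `= u` after, is again a distributional Euler pair, so by
`…SeparableEulerBrackets` (`θ` not a solution of the collapse ODE) `U` is weakly orthogonal to all divergence-free test fields — in
particular to the curl pairs `(∂ₐg)c − (∂_c g)a` — and weakly divergence free; hence every coordinate of `U` is weakly harmonic
(tree `integral_laplacian_mul_inner_eq_zero_of_curlPair` [LemarieRieusset2016 Thm 4.4]) of sub-volume growth, so `U = 0` a.e.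
(tree `ae_eq_zero_of_weaklyHarmonic_of_growth`), `u = 0` a.e. on the past slab, and `AePastSteady` concludes.

WHAT THIS IS NOT: not a proof of the stub or of the crux; nothing about Navier–Stokes. [folklore]
-/

noncomputable section

-- flat `Theorems/<Route><Decl>…` files of one crux share the namespace of the crux (tree convention)
set_option linter.dupNamespace false

open MeasureTheory Set Filter Topology Metric Function TopologicalSpace
open scoped RealInnerProductSpace NNReal ENNReal ContDiff Laplacian

namespace Summit.NavierStokesRegularity.NavierStokesRegularity.Theorems.PowerGaugeEulerLiouville

open Literature.Analysis Literature.Analysis.FunctionSpaces Literature.Analysis.FluidPDE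

namespace SeparableEuler

/-- The curl pair `(∂ₐg) c − (∂_c g) a` of a test function is divergence free (tree `divergence_curlPair_eq_zero`, unfolded). [folklore] -/
theorem divergence_curlPair_eq_zero' {g : EuclideanSpace ℝ (Fin 3) → ℝ}
    (hg : IsTestFunctionOn (⊤ : Opens (EuclideanSpace ℝ (Fin 3))) g) (a c z : EuclideanSpace ℝ (Fin 3)) :
    VectorCalculus.divergence (fun x => fderiv ℝ g x a • c - fderiv ℝ g x c • a) z = 0 := by
  have e : (fun x : EuclideanSpace ℝ (Fin 3) => fderiv ℝ g x a • c - fderiv ℝ g x c • a) =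
      fun x => ((ContinuousLinearMap.apply ℝ ℝ a).smulRight c - (ContinuousLinearMap.apply ℝ ℝ c).smulRight a)
        (fderiv ℝ g x) := by
    funext x; simp
  rw [e]
  exact divergence_curlPair_eq_zero (a := a) (c := c) hg.contDiff z

/-- **SEPARABLE PASTS ARE TRIVIAL UNLESS `θ' = λθ²`.**  Let `(u, p)` be a suitable weak Euler pair on `(−∞,0) × ℝ³` with weak spatial
gradient `H` and gauges `a^{2ρ} A(a) + a^{ρ} E(a) + a^{2ρ} D(a) ≤ c` (`ρ > 0`); suppose `u(τ, x) = θ(τ) U(x)` for a.e.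
`(τ, x) ∈ (−∞, T₁) × ℝ³` (`T₁ ≤ 0`, `U` arbitrary, `θ ∈ C¹`) and that `θ` does not solve `θ' = λ θ²` on `(−∞,T₁)` for any `λ ∈ ℝ`.
Then `u = 0` a.e. on the slab. [folklore] -/
theorem ae_eq_zero_of_gauge_of_aeSeparableEuler {ρ : ℝ} (hρ : 0 < ρ)
    {u : ℝ → EuclideanSpace ℝ (Fin 3) → EuclideanSpace ℝ (Fin 3)} {p : ℝ → EuclideanSpace ℝ (Fin 3) → ℝ}
    {H : ℝ → EuclideanSpace ℝ (Fin 3) → EuclideanSpace ℝ (Fin 3) →L[ℝ] EuclideanSpace ℝ (Fin 3)} {c : ℝ≥0}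
    (hsw : IsSuitableWeakSolutionOn (slab (EuclideanSpace ℝ (Fin 3)) (Iio 0) isOpen_Iio) 0 0 u p)
    (hH : HasWeakSpatialGradientOn (slab (EuclideanSpace ℝ (Fin 3)) (Iio 0) isOpen_Iio) u H)
    (hc : ∀ a : ℝ, 0 < a → ENNReal.ofReal (a ^ (2 * ρ)) * cknA a (0 : ℝ × EuclideanSpace ℝ (Fin 3)) u +
        ENNReal.ofReal (a ^ ρ) * cknE a (0 : ℝ × EuclideanSpace ℝ (Fin 3)) H +
        ENNReal.ofReal (a ^ (2 * ρ)) * cknD a (0 : ℝ × EuclideanSpace ℝ (Fin 3)) p ≤ (c : ℝ≥0∞))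
    {T₁ : ℝ} (hT₁ : T₁ ≤ 0) {θ : ℝ → ℝ} (hθ1 : ContDiff ℝ 1 θ)
    (hode : ¬ ∃ l : ℝ, ∀ t, t < T₁ → deriv θ t = l * θ t ^ 2)
    {U : EuclideanSpace ℝ (Fin 3) → EuclideanSpace ℝ (Fin 3)}
    (hU : ∀ᵐ z ∂(volume.restrict (Iio T₁ ×ˢ (univ : Set (EuclideanSpace ℝ (Fin 3))))), u z.1 z.2 = θ z.1 • U z.2) :
    uncurry u =ᵐ[volume.restrict (Iio (0 : ℝ) ×ˢ (univ : Set (EuclideanSpace ℝ (Fin 3))))] 0 := by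
  classical
  have hθc : Continuous θ := hθ1.continuous
  have hA : ∀ a : ℝ, 0 < a →
      ENNReal.ofReal (a ^ (2 * ρ)) * cknA a (0 : ℝ × EuclideanSpace ℝ (Fin 3)) u ≤ (c : ℝ≥0∞) :=
    fun a ha => le_trans (le_add_right (le_add_right le_rfl)) (hc a ha)
  -- ## (1) good slices and a good slice with `θ ≠ 0`
  have hgood : ∀ᵐ τ ∂(volume.restrict (Iio T₁)),
      LocallyIntegrable (u τ) volume ∧ ∀ᵐ x ∂(volume : Measure (EuclideanSpace ℝ (Fin 3))), u τ x = θ τ • U x := by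
    filter_upwards [FrameSteady.ae_hasWeakFDerivOn_slice_past hH hT₁,
      AffinePast.ae_ae_of_ae_slab (P := fun τ x => u τ x = θ τ • U x) hU] with τ hτ hτ'
    exact ⟨locallyIntegrableOn_univ.1 (by simpa only [Opens.coe_top] using hτ.locallyIntegrableOn), hτ'⟩
  obtain ⟨ts, hts, hθts⟩ : ∃ t, t < T₁ ∧ θ t ≠ 0 := by
    by_contra hne
    push Not at hne
    apply hode
    refine ⟨0, fun t ht => ?_⟩
    have hev : θ =ᶠ[𝓝 t] fun _ => (0 : ℝ) := by
      filter_upwards [Iio_mem_nhds ht] with s hs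
      exact hne s hs
    rw [hev.deriv_eq, deriv_const]
    ring
  obtain ⟨τ₀, hτ₀T, hθ₀, hgood₀⟩ : ∃ τ, τ < T₁ ∧ θ τ ≠ 0 ∧ (LocallyIntegrable (u τ) volume ∧
      ∀ᵐ x ∂(volume : Measure (EuclideanSpace ℝ (Fin 3))), u τ x = θ τ • U x) := by
    have hev : ∀ᶠ s in 𝓝 ts, θ s ≠ 0 ∧ s < T₁ :=
      (hθc.continuousAt.eventually_ne hθts).and (Iio_mem_nhds hts)
    obtain ⟨ε, hε, hball⟩ := Metric.mem_nhds_iff.1 hev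
    have hwin : volume (ball ts ε) ≠ 0 := (measure_ball_pos volume ts hε).ne'
    have hsub : ball ts ε ⊆ Iio T₁ := fun s hs => (hball hs).2
    obtain ⟨τ, hτ, hg⟩ := Measure.exists_mem_of_measure_ne_zero_of_ae hwin (ae_restrict_of_ae_restrict_of_subset hsub hgood)
    exact ⟨τ, (hball hτ).2, (hball hτ).1, hg⟩
  have hτ₀0 : τ₀ < 0 := lt_of_lt_of_le hτ₀T hT₁
  -- ## (2) `U ∈ L¹_loc`, `|U|² ∈ L¹_loc`, growth
  have hUae : U =ᵐ[volume] fun x => (θ τ₀)⁻¹ • u τ₀ x := by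
    filter_upwards [hgood₀.2] with x hx
    rw [hx, smul_smul, inv_mul_cancel₀ hθ₀, one_smul]
  have hUl : LocallyIntegrable U volume := by
    have h1 : LocallyIntegrableOn (fun x => (θ τ₀)⁻¹ • u τ₀ x) univ volume :=
      (locallyIntegrableOn_univ.2 hgood₀.1).smul (θ τ₀)⁻¹
    exact locallyIntegrableOn_univ.1 (h1.congr (by rw [Measure.restrict_univ]; exact hUae.symm))
  have hUm : AEStronglyMeasurable U volume := hUl.aestronglyMeasurable
  have hballU : ∀ a : ℝ, Real.sqrt (-τ₀) < a → 0 < a →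
      ∫⁻ x in ball (0 : EuclideanSpace ℝ (Fin 3)) a, ‖U x‖ₑ ^ 2 ≤ ENNReal.ofReal ((c : ℝ) / θ τ₀ ^ 2 * a ^ (1 - 2 * ρ)) := by
    intro a ha ha0
    have hτa : τ₀ ∈ Ioo (-(a ^ 2)) 0 := by
      refine ⟨?_, hτ₀0⟩
      have h1 : Real.sqrt (-τ₀) ^ 2 = -τ₀ := Real.sq_sqrt (by linarith)
      have h3 : Real.sqrt (-τ₀) ^ 2 < a ^ 2 := pow_lt_pow_left₀ ha (Real.sqrt_nonneg _) two_ne_zero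
      linarith
    have h := Backward.lintegral_ball_le_of_gaugeA ha0 (hA a ha0) hτa
    have e1 : ∫⁻ x in ball (0 : EuclideanSpace ℝ (Fin 3)) a, ‖u τ₀ x‖ₑ ^ 2 =
        ‖θ τ₀‖ₑ ^ 2 * ∫⁻ x in ball (0 : EuclideanSpace ℝ (Fin 3)) a, ‖U x‖ₑ ^ 2 := by
      rw [← lintegral_const_mul' _ _ (ENNReal.pow_ne_top enorm_ne_top)]
      refine lintegral_congr_ae (ae_restrict_of_ae ?_)
      filter_upwards [hgood₀.2] with x hx
      rw [hx, enorm_smul, mul_pow]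
    rw [e1] at h
    have hpos : ‖θ τ₀‖ₑ ^ 2 ≠ 0 := pow_ne_zero _ (by rwa [ne_eq, enorm_eq_zero])
    have htop : ‖θ τ₀‖ₑ ^ 2 ≠ ⊤ := ENNReal.pow_ne_top enorm_ne_top
    have h2 : ∫⁻ x in ball (0 : EuclideanSpace ℝ (Fin 3)) a, ‖U x‖ₑ ^ 2 ≤
        (‖θ τ₀‖ₑ ^ 2)⁻¹ * ENNReal.ofReal ((c : ℝ) * a ^ (1 - 2 * ρ)) := by
      rw [← ENNReal.div_eq_inv_mul]
      exact ENNReal.le_div_iff_mul_le (Or.inl hpos) (Or.inl htop) |>.2 (by rwa [mul_comm])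
    refine h2.trans (le_of_eq ?_)
    rw [Real.enorm_eq_ofReal_abs, ← ENNReal.ofReal_pow (abs_nonneg _), sq_abs,
      ← ENNReal.ofReal_inv_of_pos (by positivity), ← ENNReal.ofReal_mul (by positivity)]
    congr 1
    field_simp
  have hU2 : LocallyIntegrable (fun y => ‖U y‖ ^ 2) volume := by
    refine locallyIntegrableOn_univ.1 ((locallyIntegrableOn_iff isClosed_univ.isLocallyClosed).2 fun K _ hK => ?_)
    obtain ⟨R, hR⟩ := hK.isBounded.subset_ball 0
    set a : ℝ := max R (Real.sqrt (-τ₀)) + 1 with ha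
    have haR : R < a := by have := le_max_left R (Real.sqrt (-τ₀)); linarith
    have has : Real.sqrt (-τ₀) < a := by have := le_max_right R (Real.sqrt (-τ₀)); linarith
    have ha0 : 0 < a := lt_of_le_of_lt (Real.sqrt_nonneg _) has
    refine IntegrableOn.mono_set ?_ (hR.trans (ball_subset_ball haR.le))
    refine ⟨(hUm.norm.pow 2).restrict, ?_⟩
    have hfin := (hballU a has ha0).trans_lt ENNReal.ofReal_lt_top
    refine lt_of_le_of_lt (lintegral_mono fun x => le_of_eq ?_) hfin
    rw [Real.enorm_eq_ofReal (sq_nonneg _), ← ofReal_norm, ENNReal.ofReal_pow (norm_nonneg _)]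
  -- ## (3) the a.e.-modified field with literal separable slices is again an Euler pair
  set v : ℝ → EuclideanSpace ℝ (Fin 3) → EuclideanSpace ℝ (Fin 3) := fun τ x => if τ < T₁ then θ τ • U x else u τ x with hvdef
  have hvu : ∀ᵐ z ∂(volume.restrict ((slab (EuclideanSpace ℝ (Fin 3)) (Iio 0) isOpen_Iio : Opens (ℝ × EuclideanSpace ℝ (Fin 3))) :
      Set (ℝ × EuclideanSpace ℝ (Fin 3)))), uncurry u z = uncurry v z := by
    rw [coe_slab]
    have h1 : ∀ᵐ z ∂(volume.restrict (Iio (0 : ℝ) ×ˢ (univ : Set (EuclideanSpace ℝ (Fin 3))))),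
        z ∈ Iio T₁ ×ˢ (univ : Set (EuclideanSpace ℝ (Fin 3))) → u z.1 z.2 = θ z.1 • U z.2 :=
      ae_restrict_of_ae (ae_imp_of_ae_restrict hU)
    filter_upwards [h1] with z hz
    by_cases ht : z.1 < T₁
    · simp only [uncurry, hvdef, if_pos ht]
      exact hz ⟨ht, mem_univ _⟩
    · simp only [uncurry, hvdef, if_neg ht]
  have hsol : IsDistributionalNSSolutionOn (slab (EuclideanSpace ℝ (Fin 3)) (Iio 0) isOpen_Iio) 0 0 v p :=
    (hsw.congr_ae hvu (Eventually.of_forall fun _ => rfl)).distributional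
  have hv : ∀ τ, τ < T₁ → v τ = fun x => θ τ • U x := fun τ hτ => funext fun x => if_pos hτ
  -- ## (4) `U` is weakly curl free and weakly divergence free
  have hcurl : ∀ g : EuclideanSpace ℝ (Fin 3) → ℝ, IsTestFunctionOn (⊤ : Opens (EuclideanSpace ℝ (Fin 3))) g →
      ∀ a b : EuclideanSpace ℝ (Fin 3), ∫ x, ⟪U x, fderiv ℝ g x a • b - fderiv ℝ g x b • a⟫ = 0 :=
    fun g hg a b => integral_inner_eq_zero_of_not_ode hsol hT₁ hv hθ1 hode hUl hU2 (isTestFunctionOn_curlPair hg a b)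
      (divergence_curlPair_eq_zero' hg a b)
  have hdivU : IsWeaklyDivFree U := isWeaklyDivFree_of_not_ode hsol hT₁ hv hθ1 hode
  -- ## (5) every coordinate of `U` is weakly harmonic of sub-volume growth, hence `U = 0` a.e.
  have hcoord : ∀ i : Fin 3, (fun x => ⟪U x, EuclideanSpace.single i (1 : ℝ)⟫) =ᵐ[volume] 0 := by
    intro i
    set a : (EuclideanSpace ℝ (Fin 3)) := EuclideanSpace.single i (1 : ℝ) with ha
    have ha1 : ‖a‖ = 1 := by rw [ha, PiLp.norm_single, norm_one]
    refine ae_eq_zero_of_weaklyHarmonic_of_growth (K := (c : ℝ) / θ τ₀ ^ 2) (m := 1 - 2 * ρ) (r₀ := Real.sqrt (-τ₀)) ?_ ?_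
      (by linarith) ?_
    · have e1 : (fun x => ⟪U x, a⟫) = fun x => (innerSL ℝ a) (U x) := by
        funext x; simp only [innerSL_apply_apply, real_inner_comm]
      rw [e1, ← locallyIntegrableOn_univ]
      exact (innerSL ℝ a).locallyIntegrableOn_comp (locallyIntegrableOn_univ.2 hUl)
    · intro φ hφ hφc
      have hθ : IsTestFunctionOn (⊤ : Opens (EuclideanSpace ℝ (Fin 3))) φ := ⟨hφ, hφc, by simp⟩
      have := integral_laplacian_mul_inner_eq_zero_of_curlPair hUl hdivU hcurl hθ a
      rw [← this]
      exact integral_congr_ae (Eventually.of_forall fun x => by simp only [mul_comm])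
    · intro r hr hr0
      refine le_trans (lintegral_mono fun x => ?_) (hballU r hr hr0)
      gcongr
      rw [← ofReal_norm, ← ofReal_norm]
      exact ENNReal.ofReal_le_ofReal ((norm_inner_le_norm _ _).trans (by rw [ha1, mul_one]))
  have hU0 : ∀ᵐ x ∂(volume : Measure (EuclideanSpace ℝ (Fin 3))), U x = 0 := by
    filter_upwards [ae_all_iff.2 hcoord] with x hx
    ext i
    have h1 := hx i
    simp only [Pi.zero_apply] at h1
    rw [EuclideanSpace.inner_single_right] at h1
    simpa using h1
  -- ## (6) `u = 0` a.e. on the past slab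
  have hU' : ∀ᵐ z ∂(volume.restrict (Iio T₁ ×ˢ (univ : Set (EuclideanSpace ℝ (Fin 3))))),
      u z.1 z.2 = (fun _ : EuclideanSpace ℝ (Fin 3) => (0 : EuclideanSpace ℝ (Fin 3))) z.2 := by
    filter_upwards [hU, AffinePast.ae_slab_of_ae (T₁ := T₁) hU0] with z hz hz0
    rw [hz, hz0, smul_zero]
  exact AePastSteady.ae_eq_zero_of_gauge_of_aePastSteady hρ hsw hH hc hT₁
    (U := fun _ : EuclideanSpace ℝ (Fin 3) => (0 : EuclideanSpace ℝ (Fin 3))) hU'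

end SeparableEuler

/-- **Binder language: SEPARABLE PAST OFF THE COLLAPSE ODE ⇒ TRIVIAL** — `u(τ, x) = θ(τ) U(x)` for a.e. `(τ, x) ∈ (−∞,T₁) × ℝ³`
(`T₁ ≤ 0`, `U` arbitrary, `θ ∈ C¹(ℝ)`) with `θ` NOT a solution of `θ' = λθ²` on `(−∞,T₁)` for any `λ` ⇒ `u = 0` a.e., every `ρ > 0`
(`SeparableEuler.ae_eq_zero_of_gauge_of_aeSeparableEuler`).  Left over on the separable lane: `θ = 1/(λ(T−τ))`, the `γ = 0` collapse.
[folklore] -/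
theorem Birth.nonSelfSimilar_of_aeSeparableEuler :
    ∀ ρ : ℝ, 0 < ρ →
      ∀ (u : ℝ → EuclideanSpace ℝ (Fin 3) → EuclideanSpace ℝ (Fin 3)) (p : ℝ → EuclideanSpace ℝ (Fin 3) → ℝ)
        (H : ℝ → EuclideanSpace ℝ (Fin 3) → EuclideanSpace ℝ (Fin 3) →L[ℝ] EuclideanSpace ℝ (Fin 3)) (c : ℝ≥0),
        Birth.InClass ρ u p H c →
          (∃ T₁ : ℝ, T₁ ≤ 0 ∧ ∃ θ : ℝ → ℝ, ∃ U : EuclideanSpace ℝ (Fin 3) → EuclideanSpace ℝ (Fin 3),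
              ContDiff ℝ 1 θ ∧ (¬ ∃ l : ℝ, ∀ t, t < T₁ → deriv θ t = l * θ t ^ 2) ∧
              ∀ᵐ z ∂(volume.restrict (Iio T₁ ×ˢ (univ : Set (EuclideanSpace ℝ (Fin 3))))),
                u z.1 z.2 = θ z.1 • U z.2) →
          uncurry u =ᵐ[volume.restrict (Iio (0 : ℝ) ×ˢ (univ : Set (EuclideanSpace ℝ (Fin 3))))] 0 := by
  intro ρ hρ u p H c hcl h
  obtain ⟨T₁, hT₁, θ, U, hθ1, hode, hU⟩ := h
  exact SeparableEuler.ae_eq_zero_of_gauge_of_aeSeparableEuler hρ hcl.1 hcl.2.1 hcl.2.2 hT₁ hθ1 hode hU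

end Summit.NavierStokesRegularity.NavierStokesRegularity.Theorems.PowerGaugeEulerLiouville

end
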